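import Summits.QuantumFields.YangMills.Theorems.ParabolicTrajectoryContinuumLimitOnTrajectoryUclDefs
import Summits.QuantumFields.YangMills.Theorems.ParabolicTrajectoryContinuumLimitOnTrajectoryStubTranslB
import Summits.QuantumFields.YangMills.Theorems.ParabolicTrajectoryContinuumLimitOnTrajectoryStubTransl

/-!
# Crux `ContinuumLimitOnTrajectory` (stmt-QuantumFields-10522), line `two-orbit-synchronisation` (seat c2):
# the clustering leg — `UCL` from the core clustering estimate

Helper file (`--supports stmt-QuantumFields-10522`) for the registered stub `stub_uclOfGap : UCLOfGap`. Top layer: `UCL r sch` follows from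
(i) the translation half of E1 (`stub_transl`, landed), (ii) exact axis symmetry `AxisSymm r sch` (hypothesis of the stub), (iii) the uniform
UV bounds for the constants (`Transl.norm_curvDistribution_le_of_uuvb`), and (iv) the CORE estimate `CoreClustering r sch` (…UclDefs):
rotate the dominant-free spatial direction `i` (any `i ≠ 0` with `a i ≠ 0`) into the time axis with `σ = swap 0 i`; for `a i > 0` the
translated factor is the upper one, for `a i < 0` translate everything by `−t a` first (AsympTransl, per `t`) so that the OS adjoint becomes the
upper factor (`curvDistribution_appendTensor_comm`).
-/

set_option autoImplicit false

open scoped SchwartzMap ComplexConjugate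
open MeasureTheory Filter Topology Set
open Literature.MathematicalPhysics.QuantumFieldTheory Literature.MathematicalPhysics.QuantumLattice
open Literature.MathematicalPhysics.AQFT Literature.Probability.LatticeModels

noncomputable section

namespace Summit.QuantumFields.YangMills.Cruxes.ContinuumLimitOnTrajectory.TwoOrbitSynchronisation

local notation "𝔼" => EuclideanSpace ℝ (Fin 4)

variable {G : Type} [Group G] [TopologicalSpace G] [IsTopologicalGroup G] [CompactSpace G]
  [MeasurableSpace G] [BorelSpace G]

/-! ## Elementary facts -/

omit [TopologicalSpace G] [IsTopologicalGroup G] [CompactSpace G] [MeasurableSpace G] [BorelSpace G] [Group G] in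
/-- Translations compose additively. -/
theorem translateMulti_translateMulti' {p : ℕ} (a a' : 𝔼) (F : 𝓢((Fin p → 𝔼), ℂ)) :
    translateMulti a (translateMulti a' F) = translateMulti (a + a') F := by
  ext x; simp only [translateMulti_apply]; congr 1; funext i; abel

omit [TopologicalSpace G] [IsTopologicalGroup G] [CompactSpace G] [MeasurableSpace G] [BorelSpace G] [Group G] in
/-- Translation by `0`. -/
theorem translateMulti_zero' {p : ℕ} (F : 𝓢((Fin p → 𝔼), ℂ)) : translateMulti (0 : 𝔼) F = F := by
  ext x; simp

omit [TopologicalSpace G] [IsTopologicalGroup G] [CompactSpace G] [MeasurableSpace G] [BorelSpace G] [Group G] in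
/-- Translations distribute over appended tensors. -/
theorem translateMulti_appendTensor' {p q : ℕ} (a : 𝔼) (F : 𝓢((Fin p → 𝔼), ℂ)) (G' : 𝓢((Fin q → 𝔼), ℂ)) :
    translateMulti a (F.appendTensor G') = (translateMulti a F).appendTensor (translateMulti a G') := by
  ext x; simp [translateMulti_apply, SchwartzMap.appendTensor_apply, Function.comp_def]

/-- The swapped product formula: `cD (G' ⊗ F) = cD (F ⊗ G')` (both are `∫ obsOf F · obsOf G'`). -/
theorem curvDistribution_appendTensor_comm (r : LatticeRep G) (sch : SpeciesScheme (YMSpecies G)) (k p q : ℕ)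
    (F : 𝓢((Fin p → 𝔼), ℂ)) (G' : 𝓢((Fin q → 𝔼), ℂ)) :
    curvDistribution r sch k (q + p) (G'.appendTensor F) = curvDistribution r sch k (p + q) (F.appendTensor G') := by
  rw [curvDistribution_appendTensor r sch k q p G' F, curvDistribution_appendTensor r sch k p q F G']
  exact integral_congr_ae (Eventually.of_forall fun U => mul_comm _ _)

/-- `UUVB` bounds each curvature distribution of a fixed off-diagonal test function eventually. -/
theorem exists_eventually_norm_curvDistribution_le (r : LatticeRep G) (sch : SpeciesScheme (YMSpecies G)) (hU : UUVB r sch)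
    (p : ℕ) (F : 𝓢((Fin p → 𝔼), ℂ)) (hF : IsOffDiagonal F) : ∃ C : ℝ, 0 ≤ C ∧ ∀ᶠ k in atTop, ‖curvDistribution r sch k p F‖ ≤ C := by
  obtain ⟨s, α, β, h⟩ := Transl.norm_curvDistribution_le_of_uuvb r sch hU
  refine ⟨max 0 ((Fintype.card PlaqIdx : ℝ) ^ p * (α * (p.factorial : ℝ) ^ β * schwartzNorm (p * s) F)), le_max_left _ _, ?_⟩
  exact h.mono fun k hk => (hk p F hF).trans (le_max_right _ _)

/-- A product whose first factor is eventually bounded and whose second tends to `0` tends to `0` in norm: quantitative form. -/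
theorem eventually_norm_mul_le {u v : ℕ → ℂ} {C ε : ℝ} (hC : 0 ≤ C) (hε : 0 < ε) (hu : ∀ᶠ k in atTop, ‖u k‖ ≤ C)
    (hv : Tendsto v atTop (𝓝 0)) : ∀ᶠ k in atTop, ‖u k * v k‖ ≤ ε := by
  have hv' : ∀ᶠ k in atTop, ‖v k‖ ≤ ε / (C + 1) := by
    have := hv.norm
    rw [norm_zero] at this
    exact (this.eventually (ge_mem_nhds (by positivity))).mono fun k hk => hk
  filter_upwards [hu, hv'] with k hk1 hk2
  rw [norm_mul]
  calc ‖u k‖ * ‖v k‖ ≤ C * (ε / (C + 1)) := mul_le_mul hk1 hk2 (norm_nonneg _) hC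
    _ ≤ ε := by
        rw [mul_div_assoc']
        rw [div_le_iff₀ (by positivity)]
        nlinarith

/-! ## The reduction -/

/-- **`UCL` from the core estimate** (registered anchor of this file). -/
theorem ucl_of_core :
    ∀ {G : Type} [Group G] [TopologicalSpace G] [IsTopologicalGroup G] [CompactSpace G] [MeasurableSpace G] [BorelSpace G]
      (r : LatticeRep G) (sch : SpeciesScheme (YMSpecies G)),
      AxisSymm r sch → PolyVolumeGrowth sch → UUVB r sch → CoreClustering r sch → UCL r sch := by
  intro G _ _ _ _ _ _ r sch hAx hGr hU hcore
  have hTr : AsympTransl r sch := stub_transl G r sch hGr hU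
  intro n m F G' hF hG a ha0 ha ε hε
  -- the OS adjoint and the geometry
  set F₀ : 𝓢((Fin n → 𝔼), ℂ) := osAdjoint F with hF₀def
  have hF₀av : AvoidsLocus F₀ := avoidsLocus_osAdjoint_of_isTimeOrdered hF
  have hGav : AvoidsLocus G' := avoidsLocus_of_isTimeOrdered hG
  have hF₀neg : tsupport (F₀ : (Fin n → 𝔼) → ℂ) ⊆ {x | ∀ j, x j 0 < 0} := tsupport_osAdjoint_subset_neg hF
  have hGpos : tsupport (G' : (Fin m → 𝔼) → ℂ) ⊆ {x | ∀ j, 0 < x j 0} := tsupport_subset_pos_of_isTimeOrdered hG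
  obtain ⟨i, hi0, hai⟩ := exists_coord_ne_zero ha0 ha
  set σ : Equiv.Perm (Fin 4) := Equiv.swap 0 i with hσdef
  set R : 𝔼 ≃ₗᵢ[ℝ] 𝔼 := LinearIsometryEquiv.piLpCongrLeft 2 ℝ ℝ σ with hRdef
  have hσ0 : σ 0 = i := by rw [hσdef, Equiv.swap_apply_left]
  -- rotated data
  set Φ : 𝓢((Fin n → 𝔼), ℂ) := linActMulti R F₀ with hΦdef
  set Ψ : 𝓢((Fin m → 𝔼), ℂ) := linActMulti R G' with hΨdef
  have hΦav : AvoidsLocus Φ := hF₀av.linActMulti R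
  have hΨav : AvoidsLocus Ψ := hGav.linActMulti R
  have hΦsupp : tsupport (Φ : (Fin n → 𝔼) → ℂ) ⊆ {x | ∀ j, x j i < 0} := by
    have h := tsupport_linActMulti_piLpCongrLeft_subset σ F₀ (P := fun s => s < 0) 0 hF₀neg
    rw [hσ0] at h; exact h
  have hΨsupp : tsupport (Ψ : (Fin m → 𝔼) → ℂ) ⊆ {x | ∀ j, ¬ (x j i < 0)} := by
    have h := tsupport_linActMulti_piLpCongrLeft_subset σ G' (P := fun s => 0 < s) 0 hGpos
    rw [hσ0] at h
    exact fun x hx j => not_lt.2 (h hx j).le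
  have hRa0 : R a 0 = a i := by
    rw [hRdef, piLpCongrLeft_apply_coord]; simp [hσdef, Equiv.swap_apply_left]
  have hRai : R a i = 0 := by
    rw [hRdef, piLpCongrLeft_apply_coord]
    have : σ.symm i = 0 := by rw [hσdef, Equiv.symm_swap, Equiv.swap_apply_right]
    rw [this, ha0]
  -- constants
  obtain ⟨CF, hCF0, hCF⟩ := exists_eventually_norm_curvDistribution_le r sch hU n F₀ hF₀av.isOffDiagonal
  obtain ⟨CG, hCG0, hCG⟩ := exists_eventually_norm_curvDistribution_le r sch hU m G' hGav.isOffDiagonal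
  -- the two signs of `a i`
  rcases lt_or_gt_of_ne hai with hneg | hpos
  · /- `a i < 0`: lower factor `Ψ = RG`, upper `Φ = RF₀`, translation vector `-(R a)` (positive time component). -/
    have hb0 : 0 < (-(R a)) 0 := by rw [PiLp.neg_apply, hRa0]; linarith
    have hbi : (-(R a)) i = 0 := by rw [PiLp.neg_apply, hRai, neg_zero]
    obtain ⟨t₀, ht₀⟩ := hcore m n Ψ Φ hΨav hΦav i hi0 (fun s => ¬ (s < 0)) hΨsupp
      (fun x hx j => by simpa using hΦsupp hx j) (-(R a)) hb0 hbi (ε / 3) (by positivity)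
    refine ⟨t₀, fun t ht H hH => ?_⟩
    have hH' : H = F₀.appendTensor (translateMulti (t • a) G') := by ext x; rw [hH x, SchwartzMap.appendTensor_apply]
    -- identity relating the core quantity to the translated original
    have key : ∀ k, curvDistribution r sch k (m + n) (Ψ.appendTensor (translateMulti (t • -(R a)) Φ)) =
        curvDistribution r sch k (n + m) (translateMulti (-(t • a)) H) := by
      intro k
      rw [hH', translateMulti_appendTensor', translateMulti_translateMulti', neg_add_cancel, translateMulti_zero',
        ← hAx k (n + m) σ, linActMulti_appendTensor, linActMulti_translateMulti, curvDistribution_appendTensor_comm]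
      congr 2
      rw [map_neg, map_smul, smul_neg]
    have key1 : ∀ k, curvDistribution r sch k n (translateMulti (t • -(R a)) Φ) =
        curvDistribution r sch k n (translateMulti (-(t • a)) F₀) := by
      intro k
      rw [← hAx k n σ (translateMulti (-(t • a)) F₀), linActMulti_translateMulti]
      congr 2
      rw [map_neg, map_smul, smul_neg]
    have key2 : ∀ k, curvDistribution r sch k m Ψ = curvDistribution r sch k m G' := fun k => hAx k m σ G'
    -- the two translation errors vanish in the limit (per `t`)
    have hHod : IsOffDiagonal H := by
      rw [hH']
      have := avoidsLocus_appendTensor_of_sep hF₀av (hGav.translateMulti (t • a)) 0 0 hF₀neg ?_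
      · exact this.isOffDiagonal
      · intro x hx j
        have h := tsupport_translateMulti_subset_preimage (t • a) G' hx
        have := hGpos h j
        simpa [ha0] using this
    have e1 : Tendsto (fun k => curvDistribution r sch k (n + m) (translateMulti (-(t • a)) H) -
        curvDistribution r sch k (n + m) H) atTop (𝓝 0) := hTr (n + m) H hHod (-(t • a))
    have e2 : Tendsto (fun k => curvDistribution r sch k n (translateMulti (-(t • a)) F₀) -
        curvDistribution r sch k n F₀) atTop (𝓝 0) := hTr n F₀ hF₀av.isOffDiagonal (-(t • a))
    have e1' : ∀ᶠ k in atTop, ‖curvDistribution r sch k (n + m) (translateMulti (-(t • a)) H) -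
        curvDistribution r sch k (n + m) H‖ ≤ ε / 3 := by
      have := e1.norm; rw [norm_zero] at this
      exact (this.eventually (ge_mem_nhds (by positivity))).mono fun k hk => hk
    have e2' : ∀ᶠ k in atTop, ‖curvDistribution r sch k m G' * (curvDistribution r sch k n (translateMulti (-(t • a)) F₀) -
        curvDistribution r sch k n F₀)‖ ≤ ε / 3 := eventually_norm_mul_le hCG0 (by positivity) hCG e2
    filter_upwards [ht₀ t ht, e1', e2'] with k hk h1 h2
    rw [key k, key1 k, key2 k] at hk
    -- ‖cD H − cD F₀ cD G'‖ ≤ core + e1 + e2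
    have htri : curvDistribution r sch k (n + m) H - curvDistribution r sch k n F₀ * curvDistribution r sch k m G' =
        (curvDistribution r sch k (n + m) (translateMulti (-(t • a)) H) -
          curvDistribution r sch k m G' * curvDistribution r sch k n (translateMulti (-(t • a)) F₀)) -
        (curvDistribution r sch k (n + m) (translateMulti (-(t • a)) H) - curvDistribution r sch k (n + m) H) +
        curvDistribution r sch k m G' * (curvDistribution r sch k n (translateMulti (-(t • a)) F₀) -
          curvDistribution r sch k n F₀) := by ring
    rw [htri]
    refine (norm_add_le _ _).trans ?_
    refine (add_le_add (norm_sub_le _ _) le_rfl).trans ?_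
    linarith
  · /- `0 < a i`: lower factor `Φ = RF₀`, upper `Ψ = RG`, translation vector `R a`. -/
    have hb0 : 0 < (R a) 0 := by rw [hRa0]; exact hpos
    obtain ⟨t₀, ht₀⟩ := hcore n m Φ Ψ hΦav hΨav i hi0 (fun s => s < 0) hΦsupp hΨsupp (R a) hb0 hRai (ε / 2) (half_pos hε)
    refine ⟨t₀, fun t ht H hH => ?_⟩
    have hH' : H = F₀.appendTensor (translateMulti (t • a) G') := by ext x; rw [hH x, SchwartzMap.appendTensor_apply]
    have key : ∀ k, curvDistribution r sch k (n + m) (Φ.appendTensor (translateMulti (t • R a) Ψ)) =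
        curvDistribution r sch k (n + m) H := by
      intro k
      rw [hH', ← hAx k (n + m) σ (F₀.appendTensor (translateMulti (t • a) G')), linActMulti_appendTensor,
        linActMulti_translateMulti, map_smul]
    have key1 : ∀ k, curvDistribution r sch k n Φ = curvDistribution r sch k n F₀ := fun k => hAx k n σ F₀
    have key2 : ∀ k, curvDistribution r sch k m (translateMulti (t • R a) Ψ) = curvDistribution r sch k m (translateMulti (t • a) G') := by
      intro k
      rw [← hAx k m σ (translateMulti (t • a) G'), linActMulti_translateMulti, map_smul]
    have e3 : Tendsto (fun k => curvDistribution r sch k m (translateMulti (t • a) G') - curvDistribution r sch k m G')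
        atTop (𝓝 0) := hTr m G' hGav.isOffDiagonal (t • a)
    have e3' : ∀ᶠ k in atTop, ‖curvDistribution r sch k n F₀ * (curvDistribution r sch k m (translateMulti (t • a) G') -
        curvDistribution r sch k m G')‖ ≤ ε / 2 := eventually_norm_mul_le hCF0 (half_pos hε) hCF e3
    filter_upwards [ht₀ t ht, e3'] with k hk h3
    rw [key k, key1 k, key2 k] at hk
    have htri : curvDistribution r sch k (n + m) H - curvDistribution r sch k n F₀ * curvDistribution r sch k m G' =
        (curvDistribution r sch k (n + m) H -
          curvDistribution r sch k n F₀ * curvDistribution r sch k m (translateMulti (t • a) G')) +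
        curvDistribution r sch k n F₀ * (curvDistribution r sch k m (translateMulti (t • a) G') -
          curvDistribution r sch k m G') := by ring
    rw [htri]
    refine (norm_add_le _ _).trans ?_
    linarith

end Summit.QuantumFields.YangMills.Cruxes.ContinuumLimitOnTrajectory.TwoOrbitSynchronisation

end
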